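import Summits.Ventures.PercRepro.S1TriangleKernelSixCaseA

/-!
# PercRepro — THE TRIANGLE KERNEL AT NULLITY `6`, CASE A (`|U| = 10`): THE COUNT (p8, gen 24; a feeder for S4 —
the rows `≤ 36` of the `q = 7` window)

By the classification (S1TriangleKernelSixCaseA), every triangle avoiding `x` meets `Q = U ∖ St` (`3` points) in a
single point — at most `2` per point of `Q` — or equals `Q`: at most `2·3 + 1 = 7` such triangles, against `8`
(`false_of_ncard_sdiff_star_eq_three`). Axioms: standard.
-/

open scoped Matroid

namespace PercRepro

namespace S1

open Set

variable {α : Type}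

/-- **CASE A of the kernel at nullity `6`**: with the three triangles `Cᵢ, Cⱼ, C_k` through `x` (all of them), every point
of `U` on `≥ 3` triangles, `8` triangles avoiding `x` and `|U ∖ St| = 3`, a contradiction. -/
theorem false_of_ncard_sdiff_star_eq_three (M : Matroid α) [M.Finite]
    (hC1 : ∀ L ⊆ M.E, M.eRk L = 2 → L.ncard ≤ 3)
    (hC2 : ∀ X ⊆ M.E, M.eRk X ≤ 3 → X.ncard ≤ 6) {x : α} (hx : M.IsNonloop x)
    {Ci Cj Ck : Set α} (hCi : Ci ∈ ThmN.trianglesThrough M x) (hCj : Cj ∈ ThmN.trianglesThrough M x)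
    (hCk : Ck ∈ ThmN.trianglesThrough M x) (hij : Ci ≠ Cj) (hik : Ci ≠ Ck) (hjk : Cj ≠ Ck)
    (hmem3 : ∀ C, C ∈ ThmN.trianglesThrough M x → C = Ci ∨ C = Cj ∨ C = Ck)
    (hmin3 : ∀ y ∈ ⋃₀ ThmN.triangles M, 3 ≤ (ThmN.trianglesThrough M y).ncard)
    (hS₂card : {C | M.IsCircuit C ∧ C.ncard = 3 ∧ x ∉ C}.ncard = 8)
    (hQ3 : ((⋃₀ ThmN.triangles M) \ ({x} ∪ (Ci ∪ Cj ∪ Ck))).ncard = 3) : False := by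
  classical
  set S := ThmN.triangles M with hS
  have hSfin : S.Finite :=
    M.ground_finite.finite_subsets.subset (fun C hC => hC.1.subset_ground)
  have hUE : ⋃₀ S ⊆ M.E := by
    intro z hz
    obtain ⟨C, hC, hzC⟩ := Set.mem_sUnion.1 hz
    exact hC.1.subset_ground hzC
  have hUfin : (⋃₀ S).Finite := M.ground_finite.subset hUE
  set St := ({x} ∪ (Ci ∪ Cj ∪ Ck) : Set α) with hSt
  set Q := (⋃₀ S) \ St with hQ
  have hQfin : Q.Finite := hUfin.subset Set.sdiff_subset
  set S₂ := {C | M.IsCircuit C ∧ C.ncard = 3 ∧ x ∉ C} with hS₂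
  have hS₂fin : S₂.Finite := hSfin.subset (fun C hC => ⟨hC.1, hC.2.1⟩)
  obtain ⟨hclass, htwo⟩ := kernelSix_caseA_classify M hC1 hC2 hx hCi hCj hCk hij hik hjk hmem3 hmin3 hS₂card hQ3
  set S₂f : Finset (Set α) := hS₂fin.toFinset with hS₂fdef
  have hmemS₂ : ∀ T, T ∈ S₂f ↔ T ∈ S₂ := fun T => Set.Finite.mem_toFinset hS₂fin
  have hS₂fcard : S₂f.card = 8 := by
    rw [hS₂fdef, ← Set.ncard_eq_toFinset_card _ hS₂fin, hS₂card]
  have hA5 : ∀ q ∈ Q, (S₂f.filter (fun T => T ∩ Q = {q})).card ≤ 2 := by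
    intro q hq
    have hset : {T | T ∈ S₂ ∧ T ∩ Q = {q}} = ↑(S₂f.filter (fun T => T ∩ Q = {q})) := by
      ext T
      simp only [Set.mem_setOf_eq, Finset.coe_filter, hmemS₂]
    have := htwo q hq
    rw [hset, Set.ncard_coe_finset] at this
    exact this
  set Qf : Finset α := hQfin.toFinset with hQfdef
  have hmemQ : ∀ q, q ∈ Qf ↔ q ∈ Q := fun q => Set.Finite.mem_toFinset hQfin
  have hQfcard : Qf.card = 3 := by rw [hQfdef, ← Set.ncard_eq_toFinset_card _ hQfin, hQ3]
  have hcover : S₂f ⊆ (Qf.biUnion (fun q => S₂f.filter (fun T => T ∩ Q = {q}))) ∪ {Q} := by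
    intro T hT
    have hTS₂ : T ∈ S₂ := (hmemS₂ T).1 hT
    rcases hclass T hTS₂ with ⟨q₁, hq₁Q, hq₁⟩ | hTQ
    · refine Finset.mem_union_left _ (Finset.mem_biUnion.2 ⟨q₁, (hmemQ q₁).2 hq₁Q, ?_⟩)
      rw [Finset.mem_filter]
      exact ⟨hT, hq₁⟩
    · exact Finset.mem_union_right _ (Finset.mem_singleton.2 hTQ)
  have hcount : S₂f.card ≤ 7 := by
    calc S₂f.card ≤ ((Qf.biUnion (fun q => S₂f.filter (fun T => T ∩ Q = {q}))) ∪ {Q}).card :=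
          Finset.card_le_card hcover
      _ ≤ (Qf.biUnion (fun q => S₂f.filter (fun T => T ∩ Q = {q}))).card + ({Q} : Finset (Set α)).card :=
          Finset.card_union_le _ _
      _ ≤ (∑ q ∈ Qf, (S₂f.filter (fun T => T ∩ Q = {q})).card) + 1 := by
          rw [Finset.card_singleton]
          exact Nat.add_le_add_right Finset.card_biUnion_le _
      _ ≤ (∑ _q ∈ Qf, 2) + 1 := by
          refine Nat.add_le_add_right (Finset.sum_le_sum ?_) _
          intro q hq
          exact hA5 q ((hmemQ q).1 hq)
      _ = 7 := by rw [Finset.sum_const, hQfcard, smul_eq_mul]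
  omega

end S1

end PercRepro
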